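import Summits.QuantumFields.YangMills.Theorems.BalabanUVNodesN15KingModelComplexLinkHeatKernelDecay
import Summits.QuantumFields.YangMills.Theorems.BalabanUVNodesN15KingModelComplexLinkOperatorNorm
import Summits.QuantumFields.YangMills.Theorems.BalabanUVNodesN15KingModelTorusHalfSpaces
import Mathlib.MeasureTheory.Integral.IntegralEqImproper
import Mathlib.MeasureTheory.Integral.ExpDecay
import HarnessLib
/-!
# BalabanUVNodes ∕ N15 — THE KING-MODEL RUNG (PART Ϛ-r): THE PROPER-TIME REPRESENTATION OF THE ANALYTICALLY CONTINUED COVARIANCE — on the window, `‖e^{−tM_{U,V}}‖_{ℓ²→ℓ²} ≤ e^{−tm′²}`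
# (Schur on King's symmetric heat kernel) and, over `ℂ`, `G_{U,V} = ∫₀^∞ e^{−tM_{U,V}} dt` (Bochner integral of the complexified semigroup, converging at rate `m′² = m² − 2(d+1)cε`)
# (Track A, DAG node N15 = NE2; FAN-OUT v1.1 §N15 s3 «KING-MODEL RUNG … + what the curved case adds»; count-neutral)
HONEST FRAMING.  Count-neutral (cell `pub-ymgap`, seat `pub-ymgap-dag-n15-e` g43; `--supports stmt-QuantumFields-27247 --as helper` = K3ᴬ, KEY MAP v3).  One finite torus at fixed
spacing; King's `A = 0` model, FINE covariance layer only; nothing of Bałaban's (3.42) ∕ Thm 3.4 for `G(U)` asserted; nothing continuum ∕ ℝ⁴ ∕ OS ∕ Clay; NOT a node discharge.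
WHAT IS DECIDED.  [Balaban1985BackgroundPropagators] builds its propagators and their analytic extensions from random walk ∕ proper-time expansions (p.398 l.26–27, p.399 l.25–33, Thm 3.4
p.400); [DodziukMathai2006] Thm 1.5 integrates the semigroup domination to the resolvent.  In King's model, on the window `‖U(b)‖,‖V(b)‖ ≤ 1+ε`, `2(d+1)cε < m²`:
* §1 `exp_neg_lapF_shifted_transpose` (King's heat kernel is symmetric; `lapF` symmetric = the tree's `TorusRP.lapF_transpose`, reused), `sum_exp_neg_lapF_shifted_col` (columns also sum to `e^{−tm′²}`), ★★★ **`l2_opNorm_exp_neg_cxLapF_le`**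
  — `‖e^{−tM_{U,V}}‖_{ℓ²(T×n)→ℓ²(T×n)} ≤ e^{−t(m²−2(d+1)cε)}` for all `t ≥ 0` (PART Ϛ-l's block Schur test on Ϛ-o's domination; any `𝕜`): the complexified semigroup is an `ℓ²`-CONTRACTION
  decaying at rate `m′²`; ★★ `l2_opNorm_exp_neg_covLapF_le` (unitary `U`: rate `m²`);
* §2 (`𝕜 = ℂ`) `hasDerivAt_exp_smul_neg_cxLapF` (`d∕dt e^{t·(−M)} = (−M)e^{t(−M)}`, Mathlib `hasDerivAt_exp_smul_const'` over `ℝ`), `continuous_exp_smul_neg_cxLapF`, ★ `integrableOn_exp_smul_neg_cxLapF`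
  (dominated by `e^{−tm′²}`), ★ `tendsto_inv_mul_exp_smul_neg_cxLapF`;
* §3 ★★★ **`integral_exp_neg_cxLapF_eq_inv`** — THE PROPER-TIME IDENTITY `∫_{(0,∞)} e^{t·(−M_{U,V})} dt = M_{U,V}⁻¹ = G_{U,V}` on the window (Mathlib `integral_Ioi_of_hasDerivAt_of_tendsto'` with the
  antiderivative `−G·e^{t(−M)}`); ★★ **`integral_exp_neg_covLapF_eq_inv`** — at every unitary `U`: `(−cΔ_U+m²)⁻¹ = ∫₀^∞ e^{−t(−cΔ_U+m²)}dt`.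
With PART Ϛ-o this recovers Ϛ-b's domination by integrating the heat-kernel domination in `t` (not re-derived here).
PRIOR TREE ART (by name): Ϛ-o (`l2_opNorm_blk_exp_neg_cxLapF_le`, `exp_neg_lapF_shifted_apply_nonneg`), Ϛ-p (`sum_exp_neg_lapF_shifted_row`), Ϛ-l (`l2_opNorm_le_of_blk_symm`), Ϛ-b (`cxLapF_inv_mul`,
`shifted_mass_pos`, `unitary_mem_window`), Ϛ-a (`cxLapF_adjoint`), `…TorusHalfSpaces` (`TorusRP.lapF_transpose` — dry-run `dedup.landed` caught my local copy; deleted), Mathlib (`hasDerivAt_exp_smul_const'`, `NormedAlgebra.complexToReal`, `RCLike.real_smul_eq_coe_smul`,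
`MeasureTheory.integral_Ioi_of_hasDerivAt_of_tendsto'`, `exp_neg_integrableOn_Ioi`, `Integrable.mono'`, `Matrix.exp_transpose`, `NormedSpace.exp_zero`).  Dedup (rg at filing): basename 0 files;
needles `integral_exp_neg_cxLapF|l2_opNorm_exp_neg_cxLapF|exp_smul_neg_cxLapF` 0 tree files.  Locators: [Balaban1985BackgroundPropagators] p.398 l.26–27, Thm 3.4 p.400; [DodziukMathai2006]
Thm 1.5 §1; [King1986] (4.4) p.670.  0 `sorry`, 0 `def`.
-/

noncomputable section
open scoped BigOperators ComplexConjugate ComplexOrder Topology Matrix.Norms.L2Operator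
open Finset Matrix Filter MeasureTheory Set

namespace Summit.QuantumFields.YangMills.BalabanUVNodes.N15KingModelRung.Covariant

open Literature.MathematicalPhysics.QuantumFieldTheory.LatticeDiamagneticInequality (Hopping blk)
open Literature.MathematicalPhysics.QuantumFieldTheory.Balaban1983to89.B5Prop11Plancherel (Tor unitVec)
open Literature.MathematicalPhysics.QuantumFieldTheory.King1986.Torus (lapF)

variable {d : ℕ} (K : Fin (d + 1) → ℕ) [hK : ∀ μ, NeZero (K μ)]

section AnyField

variable {𝕜 : Type*} [RCLike 𝕜] {n : Type*} [Fintype n] [DecidableEq n] {c m2 ε : ℝ}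

/-! ## §1 The semigroup is an `ℓ²`-contraction with rate `m′²` -/

/-- King's heat kernel is symmetric: `(e^{−tL′})ᵀ = e^{−tL′}`. [cite: King1986, (4.4) p.670] -/
theorem exp_neg_lapF_shifted_transpose (c' m2' t : ℝ) : (NormedSpace.exp (-(t • lapF K c' m2')))ᵀ = NormedSpace.exp (-(t • lapF K c' m2')) := by
  rw [← Matrix.exp_transpose, transpose_neg, transpose_smul, TorusRP.lapF_transpose]

/-- The COLUMNS of King's heat kernel also sum to `e^{−tm′²}`. [cite: King1986, (4.4) p.670] -/
theorem sum_exp_neg_lapF_shifted_col (c m2 ε t : ℝ) (y : Tor K) :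
    ∑ x, (NormedSpace.exp (-(t • lapF K ((1 + ε) * c) (m2 - 2 * ((d : ℝ) + 1) * c * ε)))) x y = Real.exp (-(t * (m2 - 2 * ((d : ℝ) + 1) * c * ε))) := by
  rw [← sum_exp_neg_lapF_shifted_row K c m2 ε t y]
  refine Finset.sum_congr rfl fun x _ => ?_
  have h := congr_fun (congr_fun (exp_neg_lapF_shifted_transpose K ((1 + ε) * c) (m2 - 2 * ((d : ℝ) + 1) * c * ε) t) x) y
  rw [transpose_apply] at h
  exact h.symm

/-- ★★★ **THE COMPLEXIFIED SEMIGROUP IS AN `ℓ²`-CONTRACTION WITH RATE `m′²`**: for `c ≥ 0`, `ε ≥ 0`, `t ≥ 0` and `‖U(b)‖, ‖V(b)‖ ≤ 1+ε`,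
`‖e^{−tM_{U,V}}‖_{ℓ²(T×n)→ℓ²(T×n)} ≤ e^{−t(m² − 2(d+1)cε)}` (block Schur test on PART Ϛ-o's domination by King's symmetric heat kernel).
[cite: DodziukMathai2006, Thm 1.5 §1; Balaban1985BackgroundPropagators, Thm 3.4 p.400, (3.46) p.398] -/
theorem l2_opNorm_exp_neg_cxLapF_le (hc : 0 ≤ c) {t : ℝ} (ht : 0 ≤ t) {U V : Tor K × Fin (d + 1) → Matrix n n 𝕜}
    (hU : ∀ b, ‖U b‖ ≤ 1 + ε) (hV : ∀ b, ‖V b‖ ≤ 1 + ε) :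
    ‖NormedSpace.exp (-((((t : ℝ) : 𝕜)) • cxLapF K c m2 U V))‖ ≤ Real.exp (-(t * (m2 - 2 * ((d : ℝ) + 1) * c * ε))) :=
  l2_opNorm_le_of_blk_symm K (fun x y => l2_opNorm_blk_exp_neg_cxLapF_le K hc ht hU hV x y)
    (fun x => le_of_eq (sum_exp_neg_lapF_shifted_row K c m2 ε t x)) (fun y => le_of_eq (sum_exp_neg_lapF_shifted_col K c m2 ε t y))

/-- ★★ **AT A UNITARY FIELD**: `‖e^{−t(−cΔ_U+m²)}‖_{ℓ²→ℓ²} ≤ e^{−tm²}` (`t ≥ 0`). [cite: DodziukMathai2006, Thm 1.5 §1; King1986, (4.4) p.670] -/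
theorem l2_opNorm_exp_neg_covLapF_le (hc : 0 ≤ c) (m2 : ℝ) {t : ℝ} (ht : 0 ≤ t) {U : Tor K × Fin (d + 1) → Matrix n n 𝕜}
    (hU : ∀ b, U b ∈ Matrix.unitaryGroup n 𝕜) :
    ‖NormedSpace.exp (-((((t : ℝ) : 𝕜)) • covLapF K c m2 U))‖ ≤ Real.exp (-(t * m2)) := by
  have h := l2_opNorm_exp_neg_cxLapF_le K (m2 := m2) (ε := 0) hc ht (unitary_mem_window K hU).1 (unitary_mem_window K hU).2
  rwa [cxLapF_adjoint, mul_zero, sub_zero] at h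

end AnyField

/-! ## §2 (`𝕜 = ℂ`) The antiderivative and its limits -/

section Complex

variable {n : Type*} [Fintype n] [DecidableEq n] {c m2 ε : ℝ}

omit hK [Fintype n] [DecidableEq n] in
/-- Real scalar action `t • (−M)` is `−((t:ℂ) • M)`. [folklore] -/
theorem real_smul_neg_eq (t : ℝ) (A : Matrix (Tor K × n) (Tor K × n) ℂ) : t • (-A) = -(((t : ℝ) : ℂ) • A) := by
  ext i j
  simp only [Matrix.smul_apply, Matrix.neg_apply, Complex.real_smul, smul_eq_mul, mul_neg]

/-- THE DERIVATIVE OF THE SEMIGROUP: `d∕dt e^{t(−M)} = (−M)·e^{t(−M)}` (Mathlib `hasDerivAt_exp_smul_const'` over `ℝ` in the complex matrix algebra). [folklore] -/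
theorem hasDerivAt_exp_smul_neg_cxLapF (c m2 : ℝ) (U V : Tor K × Fin (d + 1) → Matrix n n ℂ) (t : ℝ) :
    HasDerivAt (fun u : ℝ => NormedSpace.exp (u • (-cxLapF K c m2 U V))) ((-cxLapF K c m2 U V) * NormedSpace.exp (t • (-cxLapF K c m2 U V))) t := by
  haveI : CompleteSpace (Matrix (Tor K × n) (Tor K × n) ℂ) := FiniteDimensional.complete ℂ _
  exact hasDerivAt_exp_smul_const' (𝕂 := ℝ) (-cxLapF K c m2 U V) t

/-- The semigroup is continuous in `t`. [folklore] -/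
theorem continuous_exp_smul_neg_cxLapF (c m2 : ℝ) (U V : Tor K × Fin (d + 1) → Matrix n n ℂ) :
    Continuous (fun u : ℝ => NormedSpace.exp (u • (-cxLapF K c m2 U V))) :=
  continuous_iff_continuousAt.mpr fun t => (hasDerivAt_exp_smul_neg_cxLapF K c m2 U V t).continuousAt

/-- ★ ON THE WINDOW THE SEMIGROUP IS INTEGRABLE ON `(0,∞)` (dominated by `e^{−tm′²}`, `m′² > 0`). [cite: DodziukMathai2006, Thm 1.5 §1] -/
theorem integrableOn_exp_smul_neg_cxLapF (hc : 0 ≤ c) (hwin : 2 * ((d : ℝ) + 1) * c * ε < m2) {U V : Tor K × Fin (d + 1) → Matrix n n ℂ}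
    (hU : ∀ b, ‖U b‖ ≤ 1 + ε) (hV : ∀ b, ‖V b‖ ≤ 1 + ε) :
    IntegrableOn (fun u : ℝ => NormedSpace.exp (u • (-cxLapF K c m2 U V))) (Ioi (0 : ℝ)) := by
  have hm' := shifted_mass_pos hwin
  have hg := exp_neg_integrableOn_Ioi 0 hm'
  refine Integrable.mono' hg (continuous_exp_smul_neg_cxLapF K c m2 U V).aestronglyMeasurable ?_
  refine (ae_restrict_iff' measurableSet_Ioi).mpr (Filter.Eventually.of_forall fun u hu => ?_)
  have h := l2_opNorm_exp_neg_cxLapF_le K (m2 := m2) hc (le_of_lt hu) hU hV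
  rw [real_smul_neg_eq]
  calc ‖NormedSpace.exp (-(((u : ℝ) : ℂ) • cxLapF K c m2 U V))‖ ≤ Real.exp (-(u * (m2 - 2 * ((d : ℝ) + 1) * c * ε))) := h
    _ = Real.exp (-(m2 - 2 * ((d : ℝ) + 1) * c * ε) * u) := by rw [show -(u * (m2 - 2 * ((d : ℝ) + 1) * c * ε)) = -(m2 - 2 * ((d : ℝ) + 1) * c * ε) * u by ring]

/-- ★ THE ANTIDERIVATIVE TENDS TO ZERO: `−G·e^{t(−M)} → 0` as `t → ∞` on the window. [cite: DodziukMathai2006, Thm 1.5 §1] -/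
theorem tendsto_inv_mul_exp_smul_neg_cxLapF (hc : 0 ≤ c) (hwin : 2 * ((d : ℝ) + 1) * c * ε < m2) {U V : Tor K × Fin (d + 1) → Matrix n n ℂ}
    (hU : ∀ b, ‖U b‖ ≤ 1 + ε) (hV : ∀ b, ‖V b‖ ≤ 1 + ε) :
    Tendsto (fun u : ℝ => -((cxLapF K c m2 U V)⁻¹ * NormedSpace.exp (u • (-cxLapF K c m2 U V)))) atTop (𝓝 0) := by
  have hm' := shifted_mass_pos hwin
  have hexp : Tendsto (fun u : ℝ => ‖(cxLapF K c m2 U V)⁻¹‖ * Real.exp (-(u * (m2 - 2 * ((d : ℝ) + 1) * c * ε)))) atTop (𝓝 0) := by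
    have h1 : Tendsto (fun u : ℝ => u * (m2 - 2 * ((d : ℝ) + 1) * c * ε)) atTop atTop := tendsto_id.atTop_mul_const hm'
    have h2 := (Real.tendsto_exp_neg_atTop_nhds_zero.comp h1).const_mul ‖(cxLapF K c m2 U V)⁻¹‖
    rwa [mul_zero] at h2
  refine squeeze_zero_norm' ?_ hexp
  filter_upwards [eventually_ge_atTop (0 : ℝ)] with u hu
  rw [norm_neg]
  refine (norm_mul_le _ _).trans (mul_le_mul_of_nonneg_left ?_ (norm_nonneg _))
  have h := l2_opNorm_exp_neg_cxLapF_le K (m2 := m2) hc hu hU hV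
  rwa [real_smul_neg_eq]

/-! ## §3 The proper-time identity -/

/-- ★★★ **THE PROPER-TIME REPRESENTATION ON THE WINDOW**: for `c ≥ 0`, `0 ≤ ε`, `2(d+1)cε < m²` and every two-sided field with `‖U(b)‖, ‖V(b)‖ ≤ 1+ε`:
`∫_{t ∈ (0,∞)} e^{t·(−M_{U,V})} dt = M_{U,V}⁻¹ = G_{U,V}` (Bochner integral in the complex matrix algebra; the antiderivative `−G·e^{t(−M)}` tends to `0` at rate `e^{−tm′²}`).
[cite: Balaban1985BackgroundPropagators, p.398 l.26–27, Thm 3.4 p.400; DodziukMathai2006, Thm 1.5 §1; King1986, (4.4) p.670] -/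
theorem integral_exp_neg_cxLapF_eq_inv (hc : 0 ≤ c) (hε : 0 ≤ ε) (hwin : 2 * ((d : ℝ) + 1) * c * ε < m2) {U V : Tor K × Fin (d + 1) → Matrix n n ℂ}
    (hU : ∀ b, ‖U b‖ ≤ 1 + ε) (hV : ∀ b, ‖V b‖ ≤ 1 + ε) :
    ∫ u in Ioi (0 : ℝ), NormedSpace.exp (u • (-cxLapF K c m2 U V)) = (cxLapF K c m2 U V)⁻¹ := by
  haveI : CompleteSpace (Matrix (Tor K × n) (Tor K × n) ℂ) := FiniteDimensional.complete ℂ _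
  set M := cxLapF K c m2 U V with hM
  have hm : 0 < m2 := lt_of_le_of_lt (by positivity) hwin
  have hGM : M⁻¹ * M = 1 := cxLapF_inv_mul K hc hm hε hwin hU hV
  have hderiv : ∀ u ∈ Ici (0 : ℝ), HasDerivAt (fun u : ℝ => -(M⁻¹ * NormedSpace.exp (u • (-M)))) (NormedSpace.exp (u • (-M))) u := fun u _ => by
    have h := ((hasDerivAt_exp_smul_neg_cxLapF K c m2 U V u).const_mul (M⁻¹)).neg
    have hsimp : -(M⁻¹ * (-M * NormedSpace.exp (u • (-M)))) = NormedSpace.exp (u • (-M)) := by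
      rw [← Matrix.mul_assoc, Matrix.mul_neg, hGM, Matrix.neg_mul, Matrix.one_mul, neg_neg]
    rwa [hsimp] at h
  have h := integral_Ioi_of_hasDerivAt_of_tendsto' hderiv (integrableOn_exp_smul_neg_cxLapF K hc hwin hU hV)
    (tendsto_inv_mul_exp_smul_neg_cxLapF K hc hwin hU hV)
  rw [h, zero_smul, NormedSpace.exp_zero, Matrix.mul_one, zero_sub, neg_neg]

/-- ★★ **AT EVERY UNITARY FIELD**: `∫₀^∞ e^{t·(−(−cΔ_U+m²))}dt = (−cΔ_U+m²)⁻¹` (`c ≥ 0`, `m² > 0`) — the proper-time representation of PART Ͱ's covariant fine covariance.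
[cite: King1986, (4.4) p.670; Balaban1985BackgroundPropagators, (3.23) p.394, p.398 l.26–27] -/
theorem integral_exp_neg_covLapF_eq_inv (hc : 0 ≤ c) (hm : 0 < m2) {U : Tor K × Fin (d + 1) → Matrix n n ℂ} (hU : ∀ b, U b ∈ Matrix.unitaryGroup n ℂ) :
    ∫ u in Ioi (0 : ℝ), NormedSpace.exp (u • (-covLapF K c m2 U)) = (covLapF K c m2 U)⁻¹ := by
  have hwin : 2 * ((d : ℝ) + 1) * c * 0 < m2 := by rw [mul_zero]; exact hm
  have h := integral_exp_neg_cxLapF_eq_inv K (m2 := m2) hc le_rfl hwin (unitary_mem_window K hU).1 (unitary_mem_window K hU).2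
  rwa [cxLapF_adjoint] at h

end Complex

end Summit.QuantumFields.YangMills.BalabanUVNodes.N15KingModelRung.Covariant

end
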